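import Summits.QuantumFields.YangMills.Theorems.ConvexGribovBodyBrascampLiebVacuumSCCubeWitnessOfDimensionGap
import Literature.MathematicalPhysics.QuantumLattice.SU2HaarSmallBallUpper

/-!
# Crux `BrascampLiebVacuumSC` (stmt-QuantumFields-16404), line `SketchIdeator1`, skeleton v6:
# the Haar dimension gap of `SU(2)` (non-vacuity certificate for `stub_dimensionGap`)

Helper file of the line lead c3 (`prover-line-stmt-QuantumFields-16404-c3-0`). Skeleton v6
(`Cruxes/BrascampLiebVacuumSC/Lines/SketchIdeator1.lean`) derives the volume-uniform Coulomb-gauge floor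
of the crux from ONE property of `(G, r)`, the registered stub `stub_dimensionGap`: exponents `d < 3m`
and constants with BALL GROWTH `c ε^d ≤ μ{g : ‖ρ g − 1‖²_F < ε²}` and THIN INVOLUTIONS
`μ{g : ∃ j, j² = 1, ‖ρ g − ρ j‖²_F < ε²} ≤ C ε^m` for `0 < ε ≤ ε₀` (`μ` Haar probability). This file proves
that property VERBATIM for `G = SU(2)` with its fundamental representation (`ρ g = g`), with
`d = 4`, `m = 3`, `c = 1/256`, `C = 8`, `ε₀ = 1` — certifying that the registered encoding is satisfiable
and is the intended statement (its role is that of `cubeWitness_of_involutions_central` for v5).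

Proof (`dimensionGap_su2_fundamental`): on `SU(2)`, `‖U − 1‖²_F = 2(2 − Re tr U)`
(`GaugeAlgebra.froSq_one_sub_of_mem_unitaryGroup`), so the Frobenius ball of radius `ε` is the trace
neighbourhood `{2 − Re tr U < ε²/2}`; it contains `{2 − Re tr U ≤ ε²/4}`, of Haar measure `≥ (ε²/4)²/16`
(tree: `le_haarProbability_su2_two_sub_trace_le`, the cone over a small Euclidean ball), and is contained
in `{2 − Re tr U < ε²}`, of Haar measure `≤ 4 ε³` (`haarProbability_su2_two_sub_trace_lt_le`, the cone
inside a thin cylinder). The involutions of `SU(2)` are `±1` (`coe_eq_one_or_eq_neg_one_of_mul_self_eq_one`),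
so the thickened involutions lie in `B_ε(1) ∪ B_ε(−1)`, two left translates of the same ball. Everything
is proved; no named facts.
-/

set_option autoImplicit false

open scoped BigOperators Topology Matrix ENNReal
open Filter MeasureTheory
open Literature.MathematicalPhysics.QuantumFieldTheory
open Literature.MathematicalPhysics.QuantumLattice
open Summit.QuantumFields.YangMills.Cruxes.CovarianceBound.SupportWindow (froSq)

noncomputable section

namespace Summit.QuantumFields.YangMills.Theorems.BrascampLiebVacuumSC

namespace DimensionGapSU2

/-- On `SU(2)`: `‖U − 1‖²_F = 2(2 − Re tr U)`. [folklore] -/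
theorem froSq_coe_sub_one (U : Matrix.specialUnitaryGroup (Fin 2) ℂ) :
    froSq ((U : Matrix (Fin 2) (Fin 2) ℂ) - 1) = 2 * (2 - ((U : Matrix (Fin 2) (Fin 2) ℂ).trace).re) := by
  rw [← DimensionGap.froSq_neg, neg_sub,
    GaugeAlgebra.froSq_one_sub_of_mem_unitaryGroup (Matrix.specialUnitaryGroup_le_unitaryGroup U.2)]
  norm_num

/-- The element `−1 ∈ SU(2)`. [folklore] -/
theorem neg_one_mem : (-1 : Matrix (Fin 2) (Fin 2) ℂ) ∈ Matrix.specialUnitaryGroup (Fin 2) ℂ := by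
  rw [Matrix.mem_specialUnitaryGroup_iff]
  refine ⟨?_, by simp [Matrix.det_neg, Fintype.card_fin]⟩
  rw [Matrix.mem_unitaryGroup_iff]
  simp

end DimensionGapSU2

open DimensionGapSU2

/-- **The Haar dimension gap of `SU(2)` (fundamental representation)** — `stub_dimensionGap` of
skeleton v6 verbatim at `G = SU(2)`, `ρ g = g`: with `d = 4 < 9 = 3m`, `c = 1/256`, `C = 8`, `ε₀ = 1`,
ball growth `ε⁴/256 ≤ μ{‖U − 1‖²_F < ε²}` and thin involutions `μ{U : ∃ j, j² = 1, ‖U − j‖²_F < ε²} ≤ 8 ε³`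
for `0 < ε ≤ 1`. [folklore] -/
theorem dimensionGap_su2_fundamental :
    ∃ (d m : ℕ) (c C ε₀ : ℝ), d < 3 * m ∧ 0 < c ∧ 0 < ε₀ ∧
      (∀ ε : ℝ, 0 < ε → ε ≤ ε₀ →
        c * ε ^ d ≤ (haarProbability (Matrix.specialUnitaryGroup (Fin 2) ℂ)
          {g : Matrix.specialUnitaryGroup (Fin 2) ℂ |
            froSq ((g : Matrix (Fin 2) (Fin 2) ℂ) - 1) < ε ^ 2}).toReal) ∧
      (∀ ε : ℝ, 0 < ε → ε ≤ ε₀ →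
        (haarProbability (Matrix.specialUnitaryGroup (Fin 2) ℂ)
          {g : Matrix.specialUnitaryGroup (Fin 2) ℂ | ∃ j : Matrix.specialUnitaryGroup (Fin 2) ℂ,
            j * j = 1 ∧ froSq ((g : Matrix (Fin 2) (Fin 2) ℂ) - (j : Matrix (Fin 2) (Fin 2) ℂ)) < ε ^ 2}).toReal
          ≤ C * ε ^ m) := by
  set μ : Measure (Matrix.specialUnitaryGroup (Fin 2) ℂ) :=
    haarProbability (Matrix.specialUnitaryGroup (Fin 2) ℂ) with hμ
  -- the Frobenius ball of radius `ε` around `1`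
  have hball_eq : ∀ ε : ℝ, {g : Matrix.specialUnitaryGroup (Fin 2) ℂ |
      froSq ((g : Matrix (Fin 2) (Fin 2) ℂ) - 1) < ε ^ 2} =
      {g : Matrix.specialUnitaryGroup (Fin 2) ℂ |
        2 - ((g : Matrix (Fin 2) (Fin 2) ℂ).trace).re < ε ^ 2 / 2} := by
    intro ε
    ext g
    simp only [Set.mem_setOf_eq, froSq_coe_sub_one]
    constructor <;> intro h <;> linarith
  -- ball growth: `ε⁴/256 ≤ μ(B_ε)` for `0 < ε ≤ 1`
  have hgrowth : ∀ ε : ℝ, 0 < ε → ε ≤ 1 → 1 / 256 * ε ^ 4 ≤ (μ {g : Matrix.specialUnitaryGroup (Fin 2) ℂ |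
      froSq ((g : Matrix (Fin 2) (Fin 2) ℂ) - 1) < ε ^ 2}).toReal := by
    intro ε hε hε1
    have hη0 : 0 < ε ^ 2 / 4 := by positivity
    have hη : ε ^ 2 / 4 ≤ 1 / 4 := by nlinarith
    have hlow := le_haarProbability_su2_two_sub_trace_le hη0 hη
    have hsub : {U : Matrix.specialUnitaryGroup (Fin 2) ℂ |
        2 - ((U : Matrix (Fin 2) (Fin 2) ℂ).trace).re ≤ ε ^ 2 / 4} ⊆
        {g : Matrix.specialUnitaryGroup (Fin 2) ℂ | froSq ((g : Matrix (Fin 2) (Fin 2) ℂ) - 1) < ε ^ 2} := by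
      rw [hball_eq]
      intro U hU
      simp only [Set.mem_setOf_eq] at hU ⊢
      linarith
    have h1 : ENNReal.ofReal ((ε ^ 2 / 4) ^ 2 / 16) ≤ μ {g : Matrix.specialUnitaryGroup (Fin 2) ℂ |
        froSq ((g : Matrix (Fin 2) (Fin 2) ℂ) - 1) < ε ^ 2} := hlow.trans (measure_mono hsub)
    have h2 := ENNReal.toReal_mono (measure_ne_top _ _) h1
    rw [ENNReal.toReal_ofReal (by positivity)] at h2
    calc 1 / 256 * ε ^ 4 = (ε ^ 2 / 4) ^ 2 / 16 := by ring
      _ ≤ _ := h2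
  -- upper bound for one ball: `μ(B_ε) ≤ 4 ε³`
  have hupper : ∀ ε : ℝ, 0 < ε → μ {g : Matrix.specialUnitaryGroup (Fin 2) ℂ |
      froSq ((g : Matrix (Fin 2) (Fin 2) ℂ) - 1) < ε ^ 2} ≤ ENNReal.ofReal (4 * ε ^ 3) := by
    intro ε hε
    have hsub : {g : Matrix.specialUnitaryGroup (Fin 2) ℂ | froSq ((g : Matrix (Fin 2) (Fin 2) ℂ) - 1) < ε ^ 2} ⊆
        {U : Matrix.specialUnitaryGroup (Fin 2) ℂ | 2 - ((U : Matrix (Fin 2) (Fin 2) ℂ).trace).re < ε ^ 2} := by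
      rw [hball_eq]
      intro U hU
      simp only [Set.mem_setOf_eq] at hU ⊢
      nlinarith
    exact (measure_mono hsub).trans (haarProbability_su2_two_sub_trace_lt_le hε)
  -- thin involutions: `μ(J_ε) ≤ 8 ε³`
  have hthin : ∀ ε : ℝ, 0 < ε → (μ {g : Matrix.specialUnitaryGroup (Fin 2) ℂ |
      ∃ j : Matrix.specialUnitaryGroup (Fin 2) ℂ, j * j = 1 ∧
        froSq ((g : Matrix (Fin 2) (Fin 2) ℂ) - (j : Matrix (Fin 2) (Fin 2) ℂ)) < ε ^ 2}).toReal ≤ 8 * ε ^ 3 := by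
    intro ε hε
    set B : Set (Matrix.specialUnitaryGroup (Fin 2) ℂ) :=
      {g | froSq ((g : Matrix (Fin 2) (Fin 2) ℂ) - 1) < ε ^ 2} with hB
    set m1 : Matrix.specialUnitaryGroup (Fin 2) ℂ := ⟨-1, neg_one_mem⟩ with hm1
    -- `J_ε ⊆ B ∪ m1 • B`
    have hsub : {g : Matrix.specialUnitaryGroup (Fin 2) ℂ |
        ∃ j : Matrix.specialUnitaryGroup (Fin 2) ℂ, j * j = 1 ∧
          froSq ((g : Matrix (Fin 2) (Fin 2) ℂ) - (j : Matrix (Fin 2) (Fin 2) ℂ)) < ε ^ 2} ⊆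
        B ∪ (fun g => m1 * g) ⁻¹' B := by
      rintro g ⟨j, hj, hgj⟩
      rcases coe_eq_one_or_eq_neg_one_of_mul_self_eq_one hj with h1 | h1
      · left
        rw [hB, Set.mem_setOf_eq, ← h1]
        exact hgj
      · right
        rw [Set.mem_preimage, hB, Set.mem_setOf_eq]
        have hcoe : (((m1 * g : Matrix.specialUnitaryGroup (Fin 2) ℂ)) : Matrix (Fin 2) (Fin 2) ℂ) - 1 =
            -((g : Matrix (Fin 2) (Fin 2) ℂ) - (j : Matrix (Fin 2) (Fin 2) ℂ)) := by
          rw [Submonoid.coe_mul, hm1, h1]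
          simp only [neg_mul, one_mul, sub_neg_eq_add]
          abel
        rw [hcoe, DimensionGap.froSq_neg]
        exact hgj
    have hle : μ {g : Matrix.specialUnitaryGroup (Fin 2) ℂ |
        ∃ j : Matrix.specialUnitaryGroup (Fin 2) ℂ, j * j = 1 ∧
          froSq ((g : Matrix (Fin 2) (Fin 2) ℂ) - (j : Matrix (Fin 2) (Fin 2) ℂ)) < ε ^ 2} ≤
        ENNReal.ofReal (4 * ε ^ 3) + ENNReal.ofReal (4 * ε ^ 3) := by
      refine (measure_mono hsub).trans ((measure_union_le _ _).trans (add_le_add (hupper ε hε) ?_))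
      rw [hμ, measure_preimage_mul]
      exact hupper ε hε
    have h2 := ENNReal.toReal_mono (by finiteness) hle
    rw [← ENNReal.ofReal_add (by positivity) (by positivity), ENNReal.toReal_ofReal (by positivity)] at h2
    linarith
  refine ⟨4, 3, 1 / 256, 8, 1, by norm_num, by norm_num, one_pos, fun ε hε hε1 => ?_, fun ε hε _ => ?_⟩
  · exact hgrowth ε hε hε1
  · exact hthin ε hε

end Summit.QuantumFields.YangMills.Theorems.BrascampLiebVacuumSC

end
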